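import Mathlib
import HarnessLib

/-!
# The parameter-shift rule for rotation-like gates (Mari–Bromley–Killoran, PRA 103, 012405, §III A)

Topic `Computability/QuantumAlgorithms`.  PUBLISHED RESULT with our proof; one definition (the
printed closed form of a "rotation-like" gate) and NO named fact (`def … : Prop`) (D-0026).
Mathlib ∕ Literature had no parameter-shift statement (`lean search 'parameterShift'`,
`'parameter shift'`: nothing); the tree's `SingleQubitRotations.lean` has the one-qubit `R_x`, `R_y`
as `Bool`-indexed matrices, of which `rotGate` below is the `n`-dimensional generalisation
(`R_x(θ) = rotGate σ_x θ`), not re-declared here.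

HONEST FRAMING: instance-level adjudication of specific advantage claims; no claim about BQP vs BPP
or the summit.

## Source (read on the materialised text) and what is taken

A. Mari, T. R. Bromley, N. Killoran, *Estimating the gradient and higher-order derivatives on
quantum hardware*, Phys. Rev. A **103**, 012405 (2021) = arXiv:2008.06517 [MariBromleyKilloran2021]
(held text `paper:arxiv-2008.06517`, chunks p0004–p0005).  §II eq. (rot_like): "`U_j(θ_j)` are
'rotation-like' gates, i.e., characterized by a generator `H_j` such that `H_j² = 𝟙` (involutory
matrix) and so: `U_j(θ_j) = e^{−(i∕2) H_j θ_j} = cos(θ_j∕2) 𝟙 − i sin(θ_j∕2) H_j`.  For example, all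
single-qubit rotations belong to this class. More generally, `H_j` can be any multi-qubit tensor
product of Pauli matrices."  §III A eq. (K_conj): "the unitary conjugation of an arbitrary operator
`K̂` by `U_j(θ_j)` can always be reduced to the sum of three terms:
`K̂(θ_j) = U_j(θ_j)† K̂ U_j(θ_j) = Â + B̂ cos(θ_j) + Ĉ sin(θ_j)`, where `Â, B̂, Ĉ` are operators
independent of `θ_j`"; eqs. (d_cos)–(d_sin): "`d cos(x)∕dx = (cos(x + s) − cos(x − s))∕(2 sin s)`,
`d sin(x)∕dx = (sin(x + s) − sin(x − s))∕(2 sin s)`, which are valid for any `s ≠ kπ`";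
eq. (K_partial_shift): "`∂_{θ_j} K̂(θ_j) = (K̂(θ_j + s) − K̂(θ_j − s))∕(2 sin(s))` … even if the
previous expression looks like a finite-difference approximation, it is actually exact";
eq. (ps_exact): "`g_j(θ) = (f(θ + s e_j) − f(θ − s e_j))∕(2 sin(s))` … for `s = π∕2` we obtain the
parameter-shift rule already studied in [Li 2017, Mitarai 2018, Schuld 2019, Mitarai 2019]".

## What is formalised (`H K : Matrix n n ℂ`, `θ s : ℝ`; the gate is DEFINED by the printed closed
## form of (rot_like) — the exponential `e^{−iθH∕2}` itself is not formalised)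

* `rotGate H θ = cos(θ∕2)•1 − (i sin(θ∕2))•H` (def) and `conjTranspose_rotGate_mul_self` — it is
  unitary when `Hᴴ = H` and `H * H = 1`;
* **`conj_rotGate_eq`** — (K_conj) with the three operators made explicit (needs only `Hᴴ = H`):
  `U(θ)ᴴ K U(θ) = ½(K + HKH) + cos θ • ½(K − HKH) + sin θ • (i∕2)(HK − KH)`;
* `hasDerivAt_trig_shift` — (d_cos)–(d_sin) packaged: for `g(θ) = a + cos θ · b + sin θ · c` in a
  normed space, `g′(θ) = (g(θ + s) − g(θ − s))∕(2 sin s)` whenever `sin s ≠ 0`;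
* **`hasDerivAt_conj_rotGate_apply_shift`** — (K_partial_shift) at the operator level (every matrix
  element);
* **`hasDerivAt_expect_conj_rotGate_shift`** — (ps_exact) for the expectation value
  `f(θ) = ψᴴ K̂(θ) ψ` of one rotation-like parameter: `f′(θ) = (f(θ + s) − f(θ − s))∕(2 sin s)`,
  in particular with `s = π∕2`: `f′(θ) = (f(θ + π∕2) − f(θ − π∕2))∕2` (`…_shift_pi_div_two`).

NOT formalised: the identification `rotGate H θ = exp(−iθH∕2)` (matrix exponential), circuits
with several parameters ∕ the interleaved constant gates `V_j` of eq. (var_circ) (they only change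
`K` and `ψ`, so the one-parameter statement is the content), the higher-order rules (Hessian,
Fubini–Study metric, §III B–C), shot-noise ∕ estimator-variance statements (§IV), and the
stochastic rule for non-involutory generators.

Context (cell pub-qadeq): gradient-cost accounting of variational ∕ QML rows (two circuit
evaluations per parameter per gradient component, exactly, not a finite difference) — e.g. the
measurement budgets typed in CLAIMS A-1471 and the simulated-QAOA ∕ QML rows.
-/

noncomputable section

open scoped Matrix ComplexConjugate

namespace Literature.Computability.QuantumAlgorithms

namespace ParameterShift

open _root_.Matrix Complex

variable {n : Type*} [Fintype n] [DecidableEq n]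

/-- **Rotation-like gate** generated by an involutory `H`: the printed closed form
`U_H(θ) = cos(θ∕2) 𝟙 − i sin(θ∕2) H` of `e^{−iθH∕2}`. [cite: MariBromleyKilloran2021, §II eq. (rot_like)] -/
def rotGate (H : Matrix n n ℂ) (θ : ℝ) : Matrix n n ℂ :=
  ((Real.cos (θ / 2) : ℝ) : ℂ) • (1 : Matrix n n ℂ) - (I * ((Real.sin (θ / 2) : ℝ) : ℂ)) • H

omit [Fintype n] in
/-- Unfolding lemma. [cite: MariBromleyKilloran2021, §II eq. (rot_like)] -/
theorem rotGate_def (H : Matrix n n ℂ) (θ : ℝ) :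
    rotGate H θ = ((Real.cos (θ / 2) : ℝ) : ℂ) • (1 : Matrix n n ℂ)
      - (I * ((Real.sin (θ / 2) : ℝ) : ℂ)) • H := rfl

omit [Fintype n] in
/-- The adjoint of a rotation-like gate with Hermitian generator: `U(θ)ᴴ = cos(θ∕2) 𝟙 + i sin(θ∕2) H`.
[cite: MariBromleyKilloran2021, §II eq. (rot_like)] -/
theorem conjTranspose_rotGate {H : Matrix n n ℂ} (hH : Hᴴ = H) (θ : ℝ) :
    (rotGate H θ)ᴴ = ((Real.cos (θ / 2) : ℝ) : ℂ) • (1 : Matrix n n ℂ)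
      + (I * ((Real.sin (θ / 2) : ℝ) : ℂ)) • H := by
  rw [rotGate_def, conjTranspose_sub, conjTranspose_smul, conjTranspose_smul, conjTranspose_one, hH]
  have h1 : star ((Real.cos (θ / 2) : ℝ) : ℂ) = ((Real.cos (θ / 2) : ℝ) : ℂ) := conj_ofReal _
  have h2 : star (I * ((Real.sin (θ / 2) : ℝ) : ℂ)) = -(I * ((Real.sin (θ / 2) : ℝ) : ℂ)) := by
    have hI : star I = -I := conj_I
    have hsr : star ((Real.sin (θ / 2) : ℝ) : ℂ) = ((Real.sin (θ / 2) : ℝ) : ℂ) := conj_ofReal _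
    rw [star_mul', hI, hsr]; ring
  rw [h1, h2, neg_smul, sub_neg_eq_add]

/-- **Rotation-like gates are unitary** (`H` Hermitian and involutory): `U(θ)ᴴ U(θ) = 𝟙`.
[cite: MariBromleyKilloran2021, §II eq. (rot_like)] -/
theorem conjTranspose_rotGate_mul_self {H : Matrix n n ℂ} (hH : Hᴴ = H) (hH2 : H * H = 1)
    (θ : ℝ) : (rotGate H θ)ᴴ * rotGate H θ = 1 := by
  rw [conjTranspose_rotGate hH, rotGate_def]
  set c : ℂ := ((Real.cos (θ / 2) : ℝ) : ℂ) with hc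
  set d : ℂ := I * ((Real.sin (θ / 2) : ℝ) : ℂ) with hd
  have hcs : c * c + ((Real.sin (θ / 2) : ℝ) : ℂ) * ((Real.sin (θ / 2) : ℝ) : ℂ) = 1 := by
    rw [hc]; norm_cast; nlinarith [Real.cos_sq_add_sin_sq (θ / 2)]
  have hdd : d * d = -(((Real.sin (θ / 2) : ℝ) : ℂ) * ((Real.sin (θ / 2) : ℝ) : ℂ)) := by
    rw [hd]; ring_nf; rw [I_sq]; ring
  calc (c • (1 : Matrix n n ℂ) + d • H) * (c • (1 : Matrix n n ℂ) - d • H)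
      = (c * c) • (1 : Matrix n n ℂ) - (d * d) • (H * H) := by
        simp only [add_mul, mul_sub, Matrix.smul_mul, Matrix.mul_smul, Matrix.one_mul,
          Matrix.mul_one, smul_smul]
        module
    _ = 1 := by rw [hH2, hdd, ← sub_smul, sub_neg_eq_add, hcs, one_smul]

/-- **Eq. (K_conj) — conjugation by a rotation-like gate is a three-term trigonometric polynomial**:
for `H` Hermitian with `H² = 𝟙` and any operator `K`,
`U(θ)ᴴ K U(θ) = ½(K + HKH) + cos θ • ½(K − HKH) + sin θ • (i∕2)(HK − KH)` — the operators
`Â, B̂, Ĉ` of the paper made explicit (only `Hᴴ = H` is used: for the printed closed form the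
identity holds even without `H² = 𝟙`, which is what makes the closed form equal `e^{−iθH∕2}` and
unitary). [cite: MariBromleyKilloran2021, §III A eq. (K_conj)] -/
theorem conj_rotGate_eq {H : Matrix n n ℂ} (hH : Hᴴ = H) (K : Matrix n n ℂ) (θ : ℝ) :
    (rotGate H θ)ᴴ * K * rotGate H θ =
      (1 / 2 : ℂ) • (K + H * K * H) + ((Real.cos θ : ℝ) : ℂ) • ((1 / 2 : ℂ) • (K - H * K * H))
        + ((Real.sin θ : ℝ) : ℂ) • ((I / 2) • (H * K - K * H)) := by
  rw [conjTranspose_rotGate hH, rotGate_def]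
  set c : ℂ := ((Real.cos (θ / 2) : ℝ) : ℂ) with hc
  set sn : ℂ := ((Real.sin (θ / 2) : ℝ) : ℂ) with hsn
  -- expand the product: `(c + i sn H) K (c − i sn H) = c²K + sn² HKH + i sn c (HK − KH)`
  have hexp : (c • (1 : Matrix n n ℂ) + (I * sn) • H) * K * (c • (1 : Matrix n n ℂ) - (I * sn) • H)
      = (c * c) • K + (sn * sn) • (H * K * H) + (I * sn * c) • (H * K - K * H) := by
    have hI : I * sn * (I * sn) = -(sn * sn) := by ring_nf; rw [I_sq]; ring
    simp only [add_mul, mul_sub, Matrix.smul_mul, Matrix.mul_smul, Matrix.one_mul,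
      Matrix.mul_one, smul_smul, smul_sub, Matrix.mul_assoc]
    rw [hI]
    module
  rw [hexp]
  -- half-angle identities: `c² = ½ + ½ cos θ`, `sn² = ½ − ½ cos θ`, `sn c = ½ sin θ`
  have h1r : Real.cos (θ / 2) * Real.cos (θ / 2) = 1 / 2 + Real.cos θ * (1 / 2) := by
    have := Real.cos_sq (θ / 2)
    rw [show 2 * (θ / 2) = θ by ring] at this
    rw [← sq]; linarith
  have h2r : Real.sin (θ / 2) * Real.sin (θ / 2) = 1 / 2 - Real.cos θ * (1 / 2) := by
    have hc2 := Real.cos_sq (θ / 2)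
    rw [show 2 * (θ / 2) = θ by ring] at hc2
    rw [← sq, Real.sin_sq]; linarith
  have h1 : c * c = 1 / 2 + ((Real.cos θ : ℝ) : ℂ) * (1 / 2) := by
    rw [hc]
    have h := congrArg (fun r : ℝ => (r : ℂ)) h1r
    push_cast at h ⊢
    exact h
  have h2 : sn * sn = 1 / 2 - ((Real.cos θ : ℝ) : ℂ) * (1 / 2) := by
    rw [hsn]
    have h := congrArg (fun r : ℝ => (r : ℂ)) h2r
    push_cast at h ⊢
    exact h
  have h3 : I * sn * c = ((Real.sin θ : ℝ) : ℂ) * (I / 2) := by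
    rw [hsn, hc]
    have : ((Real.sin θ : ℝ) : ℂ) = 2 * ((Real.sin (θ / 2) : ℝ) : ℂ) * ((Real.cos (θ / 2) : ℝ) : ℂ) := by
      norm_cast; rw [← Real.sin_two_mul, show 2 * (θ / 2) = θ by ring]
    rw [this]; ring
  rw [h1, h2, h3]
  module

/-- **Eqs. (d_cos)–(d_sin) packaged**: a function `g(θ) = a + cos θ · b + sin θ · c` with values in a
normed space satisfies the exact shift rule `g′(θ) = (g(θ + s) − g(θ − s))∕(2 sin s)` for every `s`
with `sin s ≠ 0`. [cite: MariBromleyKilloran2021, §III A eqs. (d_cos)–(d_sin)] -/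
theorem hasDerivAt_trig_shift {E : Type*} [NormedAddCommGroup E] [NormedSpace ℂ E] (a b c : E)
    {s : ℝ} (hs : Real.sin s ≠ 0) (θ : ℝ) :
    HasDerivAt (fun t : ℝ => a + ((Real.cos t : ℝ) : ℂ) • b + ((Real.sin t : ℝ) : ℂ) • c)
      (((1 / (2 * Real.sin s) : ℝ) : ℂ) •
        ((a + ((Real.cos (θ + s) : ℝ) : ℂ) • b + ((Real.sin (θ + s) : ℝ) : ℂ) • c)
          - (a + ((Real.cos (θ - s) : ℝ) : ℂ) • b + ((Real.sin (θ - s) : ℝ) : ℂ) • c))) θ := by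
  -- the derivative is `−sin θ • b + cos θ • c`
  have hcos : HasDerivAt (fun t : ℝ => ((Real.cos t : ℝ) : ℂ)) ((-Real.sin θ : ℝ) : ℂ) θ :=
    (Real.hasDerivAt_cos θ).ofReal_comp
  have hsin : HasDerivAt (fun t : ℝ => ((Real.sin t : ℝ) : ℂ)) ((Real.cos θ : ℝ) : ℂ) θ :=
    (Real.hasDerivAt_sin θ).ofReal_comp
  have hder : HasDerivAt (fun t : ℝ => a + ((Real.cos t : ℝ) : ℂ) • b + ((Real.sin t : ℝ) : ℂ) • c)
      (((-Real.sin θ : ℝ) : ℂ) • b + ((Real.cos θ : ℝ) : ℂ) • c) θ := by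
    have h := ((hasDerivAt_const θ a).add (hcos.smul_const b)).add (hsin.smul_const c)
    rw [zero_add] at h
    exact h
  refine hder.congr_deriv ?_
  -- trig: `cos(θ+s) − cos(θ−s) = −2 sin θ sin s`, `sin(θ+s) − sin(θ−s) = 2 cos θ sin s`
  have e1 : Real.cos (θ + s) - Real.cos (θ - s) = -2 * Real.sin θ * Real.sin s := by
    rw [Real.cos_add, Real.cos_sub]; ring
  have e2 : Real.sin (θ + s) - Real.sin (θ - s) = 2 * Real.cos θ * Real.sin s := by
    rw [Real.sin_add, Real.sin_sub]; ring
  have h2s : 2 * Real.sin s ≠ 0 := mul_ne_zero two_ne_zero hs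
  have k1r : -Real.sin θ = 1 / (2 * Real.sin s) * (-2 * Real.sin θ * Real.sin s) := by
    rw [eq_comm, div_mul_eq_mul_div, one_mul, div_eq_iff h2s]; ring
  have k2r : Real.cos θ = 1 / (2 * Real.sin s) * (2 * Real.cos θ * Real.sin s) := by
    rw [eq_comm, div_mul_eq_mul_div, one_mul, div_eq_iff h2s]; ring
  have k1 : ((-Real.sin θ : ℝ) : ℂ) =
      ((1 / (2 * Real.sin s) : ℝ) : ℂ) * ((Real.cos (θ + s) - Real.cos (θ - s) : ℝ) : ℂ) := by
    rw [e1]; exact_mod_cast k1r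
  have k2 : ((Real.cos θ : ℝ) : ℂ) =
      ((1 / (2 * Real.sin s) : ℝ) : ℂ) * ((Real.sin (θ + s) - Real.sin (θ - s) : ℝ) : ℂ) := by
    rw [e2]; exact_mod_cast k2r
  have hvec : (a + ((Real.cos (θ + s) : ℝ) : ℂ) • b + ((Real.sin (θ + s) : ℝ) : ℂ) • c)
      - (a + ((Real.cos (θ - s) : ℝ) : ℂ) • b + ((Real.sin (θ - s) : ℝ) : ℂ) • c)
      = ((Real.cos (θ + s) - Real.cos (θ - s) : ℝ) : ℂ) • b
        + ((Real.sin (θ + s) - Real.sin (θ - s) : ℝ) : ℂ) • c := by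
    push_cast
    module
  rw [hvec, smul_add, smul_smul, smul_smul, ← k1, ← k2]

/-- **Eq. (K_partial_shift) — the parameter-shift rule at the operator level**, stated for every
matrix element: for `H` Hermitian and involutory, `K̂(θ) := U(θ)ᴴ K U(θ)` satisfies, for every `s`
with `sin s ≠ 0`, `d∕dθ K̂(θ)_{ij} = (K̂(θ + s)_{ij} − K̂(θ − s)_{ij})∕(2 sin s)` — "even if the previous
expression looks like a finite-difference approximation, it is actually exact".
[cite: MariBromleyKilloran2021, §III A eq. (K_partial_shift)] -/
theorem hasDerivAt_conj_rotGate_apply_shift {H : Matrix n n ℂ} (hH : Hᴴ = H)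
    (K : Matrix n n ℂ) {s : ℝ} (hs : Real.sin s ≠ 0) (θ : ℝ) (i j : n) :
    HasDerivAt (fun t : ℝ => ((rotGate H t)ᴴ * K * rotGate H t) i j)
      (((1 / (2 * Real.sin s) : ℝ) : ℂ) *
        (((rotGate H (θ + s))ᴴ * K * rotGate H (θ + s)) i j
          - ((rotGate H (θ - s))ᴴ * K * rotGate H (θ - s)) i j)) θ := by
  -- by (K_conj) every matrix element is `a + cos t · b + sin t · c`
  have hentry : ∀ t : ℝ, ((rotGate H t)ᴴ * K * rotGate H t) i j =
      ((1 / 2 : ℂ) • (K + H * K * H)) i j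
        + ((Real.cos t : ℝ) : ℂ) • (((1 / 2 : ℂ) • (K - H * K * H)) i j)
        + ((Real.sin t : ℝ) : ℂ) • (((I / 2) • (H * K - K * H)) i j) := by
    intro t
    rw [conj_rotGate_eq hH K t]
    simp only [Matrix.add_apply, Matrix.smul_apply, smul_eq_mul]
  have hfun : (fun t : ℝ => ((rotGate H t)ᴴ * K * rotGate H t) i j) = fun t : ℝ =>
      ((1 / 2 : ℂ) • (K + H * K * H)) i j
        + ((Real.cos t : ℝ) : ℂ) • (((1 / 2 : ℂ) • (K - H * K * H)) i j)
        + ((Real.sin t : ℝ) : ℂ) • (((I / 2) • (H * K - K * H)) i j) := funext hentry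
  rw [hfun, hentry (θ + s), hentry (θ - s), ← smul_eq_mul]
  exact hasDerivAt_trig_shift _ _ _ hs θ

/-- **Eq. (ps_exact) — the parameter-shift rule for an expectation value**: with
`f(θ) = ψᴴ U(θ)ᴴ K U(θ) ψ` (one rotation-like parameter; any vector `ψ`, any operator `K`),
`f′(θ) = (f(θ + s) − f(θ − s))∕(2 sin s)` for every `s` with `sin s ≠ 0`: two evaluations of the
same circuit at shifted parameters give the exact derivative.
[cite: MariBromleyKilloran2021, §III A eq. (ps_exact)] -/
theorem hasDerivAt_expect_conj_rotGate_shift {H : Matrix n n ℂ} (hH : Hᴴ = H)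
    (K : Matrix n n ℂ) (ψ : n → ℂ) {s : ℝ} (hs : Real.sin s ≠ 0) (θ : ℝ) :
    HasDerivAt (fun t : ℝ => star ψ ⬝ᵥ (((rotGate H t)ᴴ * K * rotGate H t) *ᵥ ψ))
      (((1 / (2 * Real.sin s) : ℝ) : ℂ) *
        (star ψ ⬝ᵥ (((rotGate H (θ + s))ᴴ * K * rotGate H (θ + s)) *ᵥ ψ)
          - star ψ ⬝ᵥ (((rotGate H (θ - s))ᴴ * K * rotGate H (θ - s)) *ᵥ ψ))) θ := by
  -- by (K_conj) the expectation is `a + cos t · b + sin t · c` with scalar `a, b, c`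
  have hval : ∀ t : ℝ, star ψ ⬝ᵥ (((rotGate H t)ᴴ * K * rotGate H t) *ᵥ ψ) =
      star ψ ⬝ᵥ (((1 / 2 : ℂ) • (K + H * K * H)) *ᵥ ψ)
        + ((Real.cos t : ℝ) : ℂ) • (star ψ ⬝ᵥ (((1 / 2 : ℂ) • (K - H * K * H)) *ᵥ ψ))
        + ((Real.sin t : ℝ) : ℂ) • (star ψ ⬝ᵥ (((I / 2) • (H * K - K * H)) *ᵥ ψ)) := by
    intro t
    rw [conj_rotGate_eq hH K t]
    simp only [add_mulVec, smul_mulVec, dotProduct_add, dotProduct_smul]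
  have hfun : (fun t : ℝ => star ψ ⬝ᵥ (((rotGate H t)ᴴ * K * rotGate H t) *ᵥ ψ)) = fun t : ℝ =>
      star ψ ⬝ᵥ (((1 / 2 : ℂ) • (K + H * K * H)) *ᵥ ψ)
        + ((Real.cos t : ℝ) : ℂ) • (star ψ ⬝ᵥ (((1 / 2 : ℂ) • (K - H * K * H)) *ᵥ ψ))
        + ((Real.sin t : ℝ) : ℂ) • (star ψ ⬝ᵥ (((I / 2) • (H * K - K * H)) *ᵥ ψ)) := funext hval
  rw [hfun, hval (θ + s), hval (θ - s), ← smul_eq_mul]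
  exact hasDerivAt_trig_shift _ _ _ hs θ

/-- **The `s = π∕2` rule of Li ∕ Mitarai ∕ Schuld**: `f′(θ) = (f(θ + π∕2) − f(θ − π∕2))∕2`.
[cite: MariBromleyKilloran2021, §III A eq. (ps_exact) ("for `s = π∕2` we obtain the parameter-shift
rule already studied in [Li 2017, Mitarai 2018, Schuld 2019, Mitarai 2019]")] -/
theorem hasDerivAt_expect_conj_rotGate_shift_pi_div_two {H : Matrix n n ℂ} (hH : Hᴴ = H)
    (K : Matrix n n ℂ) (ψ : n → ℂ) (θ : ℝ) :
    HasDerivAt (fun t : ℝ => star ψ ⬝ᵥ (((rotGate H t)ᴴ * K * rotGate H t) *ᵥ ψ))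
      ((1 / 2 : ℂ) *
        (star ψ ⬝ᵥ (((rotGate H (θ + Real.pi / 2))ᴴ * K * rotGate H (θ + Real.pi / 2)) *ᵥ ψ)
          - star ψ ⬝ᵥ (((rotGate H (θ - Real.pi / 2))ᴴ * K * rotGate H (θ - Real.pi / 2)) *ᵥ ψ)))
      θ := by
  have hs : Real.sin (Real.pi / 2) ≠ 0 := by rw [Real.sin_pi_div_two]; norm_num
  have h := hasDerivAt_expect_conj_rotGate_shift hH K ψ hs θ
  have e : (((1 / (2 * Real.sin (Real.pi / 2)) : ℝ) : ℂ)) = (1 / 2 : ℂ) := by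
    rw [Real.sin_pi_div_two]; push_cast; ring
  rw [e] at h
  exact h

end ParameterShift

end Literature.Computability.QuantumAlgorithms

end
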